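import Literature.Probability.RandomPlanarGeometry.SAWTubeLocality
import Literature.Probability.RandomPlanarGeometry.HammersleyWelshSharp
import Mathlib.Analysis.SpecialFunctions.Pow.Asymptotics
import Mathlib.Analysis.Real.Pi.Bounds
import HarnessLib

/-!
# Locality of `μ` in tubes and slabs at width `2N`: the rate `(2π/√3 + η) T^{-1/2}`

Topic `Literature/Probability/RandomPlanarGeometry` (continues `SAWTubeBridges.lean`,
`SAWTubeLocality.lean`). Madras–Slade, *The Self-Avoiding Walk* (1993), §8.2, proof of
Theorem 8.2.1 (p. 283) works at width `2s` with bridges: "every `s`-step bridge `ω` in `ℤ^d` having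
`ω_i(0) = s` for `i = k+1,…,d` must lie entirely in `R`"; the tree's `exists_pow_le_tubeCount`
pairs the `N`-step bridges of a HEIGHT class with their vertical reflections and needs width `4N`.
Here the bridges are pigeonholed by the finer PROFILE class (vertical displacement, coordinatewise
minimum, coordinatewise maximum): a bridge of the class followed by the reflection of another one
has vertical displacement `0` and all its sites in a FIXED vertical window of width `≤ 2N`
determined by the class, so that `c_{2jN}(R[k,2N]) ≥ B^{2j}` with `b_N ≤ #offsets³ · B`
(`exists_pow_le_tubeCount_two_mul`). With the sharp Hammersley–Welsh lemma
`c_{N-1} ≤ N e^{π√(2N/3)} b_N` (`count_le_sharp_mul_bridgeCount`) this gives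

* `log_sub_log_tubeConnectiveConstant_two_mul_le` — for `N ≥ 1`,
  `log μ - log μ(R[k,2N]) ≤ (log μ + π√(2N/3) + log N + 3 log #offsets)/N`;
* **`log_sub_log_tubeConnectiveConstant_le_two_mul`** — for every `T ≥ 2` (all `d ≥ 1`, `k ≥ 1`):
  `log μ - log μ(R[k,T]) ≤ (2π/√3)/√(T-1) + 2(log μ + (6d+1) log T)/(T-1)`;
* **`eventually_log_sub_log_tubeConnectiveConstant_le_two_mul`** — for every `η > 0`, eventually:
  `log μ - log μ(R[k,T]) ≤ (2π/√3 + η)/√T` (leading constant `2π/√3 = 3.6276…`);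
* `log_sub_log_stripConnectiveConstant_le_two_mul` — the planar strip, all `T ≥ 2`:
  `log μ(ℤ²) - log μ(R[1,T]) ≤ 3.6277/√(T-1) + (8 log T + 6.6)/(T-1)`.
-/

noncomputable section

open Filter Topology Asymptotics Literature.Probability.LatticeModels Literature.Probability.Percolation
  SimpleGraph
open scoped BigOperators

namespace Literature.Probability.RandomPlanarGeometry.SAW.Zd

variable {d : ℕ}

/-! ### Coordinates move by at most one per step -/

/-- `|ω(m)_j - ω(m')_j| ≤ m - m'` for a nearest-neighbour path. [folklore] -/
private theorem abs_sub_apply_le_of_adj {ω : ℕ → Site d} {n : ℕ}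
    (hadj : ∀ i < n, (zdGraph d).Adj (ω i) (ω (i + 1))) :
    ∀ m ≤ n, ∀ m' ≤ m, ∀ j, |ω m j - ω m' j| ≤ (m : ℤ) - m' := by
  intro m
  induction m with
  | zero =>
    intro _ m' hm' j
    obtain rfl : m' = 0 := by omega
    simp
  | succ m ih =>
    intro hm m' hm' j
    rcases Nat.lt_or_ge m' (m + 1) with h | h
    · have h1 := abs_sub_le_one_of_adj (hadj m (by omega)) j
      have h2 := ih (by omega) m' (by omega) j
      calc |ω (m + 1) j - ω m' j| = |(ω (m + 1) j - ω m j) + (ω m j - ω m' j)| := by ring_nf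
        _ ≤ |ω (m + 1) j - ω m j| + |ω m j - ω m' j| := abs_add_le _ _
        _ ≤ (((m + 1 : ℕ)) : ℤ) - m' := by push_cast; linarith
    · obtain rfl : m' = m + 1 := by omega
      simp

/-! ### Vertical profiles of a walk: coordinatewise minimum and maximum -/

/-- The coordinatewise minimum of the vertical coordinates over the first `N` steps. [folklore] -/
private def loProf (k : ℕ) (ω : ℕ → Site d) (N : ℕ) : Site d :=
  fun i => if k ≤ i.val then (Finset.range (N + 1)).inf' ⟨0, by simp⟩ (fun m => ω m i) else 0

/-- The coordinatewise maximum of the vertical coordinates over the first `N` steps. [folklore] -/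
private def hiProf (k : ℕ) (ω : ℕ → Site d) (N : ℕ) : Site d :=
  fun i => if k ≤ i.val then (Finset.range (N + 1)).sup' ⟨0, by simp⟩ (fun m => ω m i) else 0

/-- `lo ≤ ω(m)`. [folklore] -/
private theorem loProf_le {k : ℕ} (ω : ℕ → Site d) {N m : ℕ} (hm : m ≤ N) {i : Fin d} (hi : k ≤ i.val) :
    loProf k ω N i ≤ ω m i := by
  simp only [loProf, if_pos hi]
  exact Finset.inf'_le (fun m => ω m i) (Finset.mem_range.2 (by omega))

/-- `ω(m) ≤ hi`. [folklore] -/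
private theorem le_hiProf {k : ℕ} (ω : ℕ → Site d) {N m : ℕ} (hm : m ≤ N) {i : Fin d} (hi : k ≤ i.val) :
    ω m i ≤ hiProf k ω N i := by
  simp only [hiProf, if_pos hi]
  exact Finset.le_sup' (fun m => ω m i) (Finset.mem_range.2 (by omega))

/-- The minimum is attained. [folklore] -/
private theorem exists_eq_loProf {k : ℕ} (ω : ℕ → Site d) (N : ℕ) {i : Fin d} (hi : k ≤ i.val) :
    ∃ m ≤ N, ω m i = loProf k ω N i := by
  obtain ⟨m, hm, h⟩ := Finset.exists_mem_eq_inf' (s := Finset.range (N + 1)) ⟨0, by simp⟩ (fun m => ω m i)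
  exact ⟨m, by rw [Finset.mem_range] at hm; omega, by simp only [loProf, if_pos hi]; exact h.symm⟩

/-- The maximum is attained. [folklore] -/
private theorem exists_eq_hiProf {k : ℕ} (ω : ℕ → Site d) (N : ℕ) {i : Fin d} (hi : k ≤ i.val) :
    ∃ m ≤ N, ω m i = hiProf k ω N i := by
  obtain ⟨m, hm, h⟩ := Finset.exists_mem_eq_sup' (s := Finset.range (N + 1)) ⟨0, by simp⟩ (fun m => ω m i)
  exact ⟨m, by rw [Finset.mem_range] at hm; omega, by simp only [hiProf, if_pos hi]; exact h.symm⟩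

/-- The profiles of an `N`-step walk from `0` are admissible offsets, and the range is `≤ N`.
[folklore] -/
private theorem prof_bounds {k N : ℕ} {ω : ℕ → Site d} (hω : ω ∈ saws d N) {i : Fin d} (hi : k ≤ i.val) :
    -(N : ℤ) ≤ loProf k ω N i ∧ loProf k ω N i ≤ 0 ∧ 0 ≤ hiProf k ω N i ∧ hiProf k ω N i ≤ N ∧
      hiProf k ω N i - loProf k ω N i ≤ N := by
  obtain ⟨h0, -, hadj, -⟩ := mem_saws.1 hω
  obtain ⟨m₁, hm₁, e₁⟩ := exists_eq_loProf ω N hi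
  obtain ⟨m₂, hm₂, e₂⟩ := exists_eq_hiProf ω N hi
  have a₁ := abs_le.1 ((abs_apply_le_of_adj h0 hadj m₁ hm₁ i).trans (by exact_mod_cast hm₁ : (m₁ : ℤ) ≤ N))
  have a₂ := abs_le.1 ((abs_apply_le_of_adj h0 hadj m₂ hm₂ i).trans (by exact_mod_cast hm₂ : (m₂ : ℤ) ≤ N))
  have hl0 : loProf k ω N i ≤ 0 := by have := loProf_le ω (Nat.zero_le N) hi (k := k); rwa [h0] at this
  have hh0 : 0 ≤ hiProf k ω N i := by have := le_hiProf ω (Nat.zero_le N) hi (k := k); rwa [h0] at this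
  have hrange : hiProf k ω N i - loProf k ω N i ≤ N := by
    rw [← e₁, ← e₂]
    rcases le_total m₁ m₂ with h | h
    · have := (le_abs_self _).trans (abs_sub_apply_le_of_adj hadj m₂ hm₂ m₁ h i)
      have hm : (m₂ : ℤ) - m₁ ≤ N := by omega
      linarith
    · have := (le_abs_self _).trans (abs_sub_apply_le_of_adj hadj m₁ hm₁ m₂ h i)
      have hm : (m₁ : ℤ) - m₂ ≤ N := by omega
      have := abs_sub_comm (ω m₂ i) (ω m₁ i)
      linarith [le_abs_self (ω m₂ i - ω m₁ i), abs_sub_apply_le_of_adj hadj m₁ hm₁ m₂ h i]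
  exact ⟨by rw [← e₁]; exact a₁.1, hl0, hh0, by rw [← e₂]; exact a₂.2, hrange⟩

/-- A `Site d` with vertical coordinates in `{-N,…,N}` and horizontal ones `0` is an offset. [folklore] -/
private theorem mem_tubeOffsets_of {k N : ℕ} {x : Site d}
    (hv : ∀ i : Fin d, k ≤ i.val → -(N : ℤ) ≤ x i ∧ x i ≤ N) (hh : ∀ i : Fin d, ¬ k ≤ i.val → x i = 0) :
    x ∈ tubeOffsets d k N := by
  rw [tubeOffsets, Fintype.mem_piFinset]
  intro i
  by_cases hi : k ≤ i.val
  · rw [if_pos hi, Finset.mem_Icc]; exact hv i hi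
  · rw [if_neg hi, Finset.mem_singleton]; exact hh i hi

/-! ### Profile classes of bridges and the pigeonhole -/

/-- The keys: (vertical displacement, minimum profile, maximum profile). [folklore] -/
private def profKeys (d k N : ℕ) : Finset (Site d × Site d × Site d) :=
  tubeOffsets d k N ×ˢ (tubeOffsets d k N ×ˢ tubeOffsets d k N)

/-- The key of a walk. [folklore] -/
private def profKey (k : ℕ) (ω : ℕ → Site d) (N : ℕ) : Site d × Site d × Site d :=
  (vproj k (ω N), loProf k ω N, hiProf k ω N)

open Classical in
/-- The profile class of `N`-step bridges with a given key. [folklore] -/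
private def profClass (d : ℕ) [NeZero d] (k N : ℕ) (key : Site d × Site d × Site d) : Finset (ℕ → Site d) :=
  (bridges d N).filter fun ω => profKey k ω N = key

/-- `#keys = #offsets³`. [folklore] -/
private theorem card_profKeys (d k N : ℕ) : (profKeys d k N).card = (tubeOffsets d k N).card ^ 3 := by
  rw [profKeys, Finset.card_product, Finset.card_product]; ring

section Classes

variable [NeZero d]

/-- Membership in a profile class. [folklore] -/
private theorem mem_profClass {k N : ℕ} {key : Site d × Site d × Site d} {ω : ℕ → Site d} :
    ω ∈ profClass d k N key ↔ ω ∈ bridges d N ∧ profKey k ω N = key := by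
  classical
  exact Finset.mem_filter

/-- The key of a bridge is admissible. [folklore] -/
private theorem profKey_mem_profKeys {k N : ℕ} {ω : ℕ → Site d} (hω : ω ∈ bridges d N) :
    profKey k ω N ∈ profKeys d k N := by
  have hs := (mem_bridges.1 hω).1
  rw [profKeys, Finset.mem_product, Finset.mem_product]
  refine ⟨vproj_mem_tubeOffsets hω, mem_tubeOffsets_of (fun i hi => ?_) (fun i hi => by simp [profKey, loProf, hi]),
    mem_tubeOffsets_of (fun i hi => ?_) (fun i hi => by simp [profKey, hiProf, hi])⟩
  · obtain ⟨h1, h2, -, -, -⟩ := prof_bounds hs hi (k := k)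
    exact ⟨h1, h2.trans (by positivity)⟩
  · obtain ⟨-, -, h3, h4, -⟩ := prof_bounds hs hi (k := k)
    exact ⟨le_trans (by simp) h3, h4⟩

/-- **Pigeonhole over profile classes**: some class has `≥ b_N / #offsets³` elements. [folklore] -/
private theorem exists_profClass (k N : ℕ) :
    ∃ key ∈ profKeys d k N, bridgeCount d N ≤ (tubeOffsets d k N).card ^ 3 * (profClass d k N key).card := by
  classical
  have hmaps : ∀ ω ∈ bridges d N, profKey k ω N ∈ profKeys d k N := fun ω hω => profKey_mem_profKeys hω
  have hne : (profKeys d k N).Nonempty := by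
    rw [← Finset.card_pos, card_profKeys]
    exact pow_pos (one_le_card_tubeOffsets d k N) 3
  obtain ⟨key, hkey, hmax⟩ := Finset.exists_max_image (profKeys d k N)
    (fun key => (profClass d k N key).card) hne
  refine ⟨key, hkey, ?_⟩
  rw [bridgeCount, Finset.card_eq_sum_card_fiberwise hmaps, ← card_profKeys]
  calc ∑ b ∈ profKeys d k N, ((bridges d N).filter fun ω => profKey k ω N = b).card
      ≤ ∑ _b ∈ profKeys d k N, (profClass d k N key).card := by
        refine Finset.sum_le_sum fun b hb => ?_
        have := hmax b hb
        rw [profClass] at this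
        convert this using 2
    _ = (profKeys d k N).card * (profClass d k N key).card := by
        rw [Finset.sum_const, smul_eq_mul]

/-! ### Window bridges -/

open Classical in
/-- `M`-step bridges with vertical displacement `0` all of whose sites have vertical coordinates in
the window `[L_i, U_i]`. [folklore] -/
private def windowBridges (d : ℕ) [NeZero d] (k : ℕ) (L U : Site d) (M : ℕ) : Finset (ℕ → Site d) :=
  (bridges d M).filter fun ω => vproj k (ω M) = 0 ∧
    ∀ m ≤ M, ∀ i : Fin d, k ≤ i.val → L i ≤ ω m i ∧ ω m i ≤ U i

/-- Membership in `windowBridges`. [folklore] -/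
private theorem mem_windowBridges {k : ℕ} {L U : Site d} {M : ℕ} {ω : ℕ → Site d} :
    ω ∈ windowBridges d k L U M ↔ ω ∈ bridges d M ∧ vproj k (ω M) = 0 ∧
      ∀ m ≤ M, ∀ i : Fin d, k ≤ i.val → L i ≤ ω m i ∧ ω m i ≤ U i := by
  classical
  exact Finset.mem_filter

/-- Window bridges concatenate (the second piece starts at vertical height `0` again). [folklore] -/
private theorem card_windowBridges_mul_le (k : ℕ) (L U : Site d) (M M' : ℕ) :
    (windowBridges d k L U M).card * (windowBridges d k L U M').card ≤
      (windowBridges d k L U (M + M')).card := by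
  rw [← Finset.card_product]
  refine Finset.card_le_card_of_injOn (fun p => concatWalk M p.1 p.2) ?_ ?_
  · rintro ⟨ω, υ⟩ hp
    simp only [Finset.mem_coe, Finset.mem_product, mem_windowBridges] at hp
    obtain ⟨⟨hω, hωe, hωW⟩, hυ, hυe, hυW⟩ := hp
    dsimp only
    obtain ⟨hυ0, -, -, -⟩ := mem_saws.1 (mem_bridges.1 hυ).1
    rw [Finset.mem_coe, mem_windowBridges]
    refine ⟨concatWalk_mem_bridges_add hω hυ, ?_, ?_⟩
    · rw [concatWalk_apply_add _ _ hυ0, vproj_add, hωe, hυe, add_zero]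
    · intro m hm i hi
      by_cases h : m ≤ M
      · rw [concatWalk_apply_of_le _ _ h]
        exact hωW m h i hi
      · obtain ⟨j, rfl⟩ : ∃ j, m = M + j := ⟨m - M, by omega⟩
        rw [concatWalk_apply_add _ _ hυ0, Pi.add_apply]
        have h0 : ω M i = 0 := by
          have := congrFun hωe i
          rwa [vproj_apply_of_le k _ hi] at this
        rw [h0, zero_add]
        exact hυW j (by omega) i hi
  · rintro ⟨ω, υ⟩ hp ⟨ω', υ'⟩ hp' h
    simp only [Finset.mem_coe, Finset.mem_product, mem_windowBridges] at hp hp'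
    dsimp only at h
    obtain ⟨h1, h2⟩ := concatWalk_injective_pieces (mem_bridges.1 hp.1.1).1 (mem_bridges.1 hp.2.1).1
      (mem_bridges.1 hp'.1.1).1 (mem_bridges.1 hp'.2.1).1 h
    simp only [Prod.mk.injEq]
    exact ⟨h1, h2⟩

/-- `#W(M)^j ≤ #W(jM)` for a window containing `0`. [folklore] -/
private theorem card_windowBridges_pow_le (k : ℕ) {L U : Site d} (hL : ∀ i : Fin d, k ≤ i.val → L i ≤ 0)
    (hU : ∀ i : Fin d, k ≤ i.val → 0 ≤ U i) (M j : ℕ) :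
    (windowBridges d k L U M).card ^ j ≤ (windowBridges d k L U (j * M)).card := by
  induction j with
  | zero =>
    rw [pow_zero, zero_mul]
    refine Finset.card_pos.2 ⟨straightWalk d 0, mem_windowBridges.2 ⟨?_, ?_, ?_⟩⟩
    · exact mem_bridges.2 ⟨straightWalk_mem_saws d 0, fun i h1 h2 => by omega⟩
    · funext i
      simp [vproj, straightWalk]
    · intro m hm i hi
      obtain rfl : m = 0 := by omega
      simp only [straightWalk]
      simp [hL i hi, hU i hi]
  | succ j ih =>
    calc (windowBridges d k L U M).card ^ (j + 1)
        = (windowBridges d k L U M).card ^ j * (windowBridges d k L U M).card := pow_succ _ _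
      _ ≤ (windowBridges d k L U (j * M)).card * (windowBridges d k L U M).card :=
          Nat.mul_le_mul_right _ ih
      _ ≤ (windowBridges d k L U (j * M + M)).card := card_windowBridges_mul_le k L U _ _
      _ = (windowBridges d k L U ((j + 1) * M)).card := by rw [Nat.succ_mul]

/-- Window bridges started at vertical height `-L` lie in `R[k,T]` when `L ≤ 0 ≤ U` and
`U - L ≤ T`: `#W(L,U,M) ≤ c_M(R[k,T])`. [folklore] -/
private theorem card_windowBridges_le_tubeCount (k : ℕ) {L U : Site d} (hL : ∀ i : Fin d, k ≤ i.val → L i ≤ 0)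
    (hU : ∀ i : Fin d, k ≤ i.val → 0 ≤ U i) {T : ℕ} (hT : ∀ i : Fin d, k ≤ i.val → U i - L i ≤ T) (M : ℕ) :
    (windowBridges d k L U M).card ≤ tubeCount d k T M := by
  set w : Site d := fun i => if k ≤ i.val then -L i else 0 with hw
  have hwS : w ∈ tubeStarts d k T := by
    refine mem_tubeStarts.2 ⟨fun i hi => ?_, fun i hi => ?_⟩
    · simp only [hw, if_pos hi]
      have h1 := hL i hi
      have h2 := hT i hi
      have h3 := hU i hi
      constructor
      · linarith
      · linarith
    · simp only [hw, if_neg hi]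
  refine Finset.card_le_card_of_injOn (fun ω => (w, ω)) ?_ ?_
  · intro ω hω
    rw [Finset.mem_coe, mem_windowBridges] at hω
    obtain ⟨hω, -, hW⟩ := hω
    rw [Finset.mem_coe, mem_tubePairs]
    refine ⟨hwS, (mem_bridges.1 hω).1, fun m hm i hi => ?_⟩
    simp only [Pi.add_apply, hw, if_pos hi]
    have := hW m hm i hi
    have h2 := hT i hi
    constructor
    · linarith [this.1]
    · linarith [this.2]
  · intro ω _ ω' _ h
    simpa using h

/-! ### The reflection pairing inside a profile class -/

/-- The vertical window of a key `(e, lo, hi)`: `[min(lo, e - hi), max(hi, e - lo)]`. [folklore] -/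
private def winLo (key : Site d × Site d × Site d) : Site d := fun i => min (key.2.1 i) (key.1 i - key.2.2 i)

/-- See `winLo`. [folklore] -/
private def winHi (key : Site d × Site d × Site d) : Site d := fun i => max (key.2.2 i) (key.1 i - key.2.1 i)

/-- **`#class² ≤ #windowBridges(2N)`**: `(ω, υ) ↦ ω ⊕ refl(υ)` is injective from pairs of bridges of
one profile class to `2N`-step bridges with vertical displacement `0` inside the window of the
class. [folklore] -/
private theorem sq_card_profClass_le {k N : ℕ} (hk : 1 ≤ k) (key : Site d × Site d × Site d) :
    (profClass d k N key).card ^ 2 ≤ (windowBridges d k (winLo key) (winHi key) (2 * N)).card := by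
  obtain ⟨e, lo, hi⟩ := key
  rw [sq, ← Finset.card_product]
  refine Finset.card_le_card_of_injOn (fun p => concatWalk N p.1 (reflectWalk k p.2)) ?_ ?_
  · rintro ⟨ω, υ⟩ hp
    simp only [Finset.mem_coe, Finset.mem_product, mem_profClass] at hp
    obtain ⟨⟨hω, hωk⟩, hυ, hυk⟩ := hp
    simp only [profKey, Prod.mk.injEq] at hωk hυk
    obtain ⟨hωe, hωlo, hωhi⟩ := hωk
    obtain ⟨hυe, hυlo, hυhi⟩ := hυk
    dsimp only
    have hυ' : reflectWalk k υ ∈ bridges d N := reflectWalk_mem_bridges hk hυ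
    obtain ⟨hυ0, -, -, -⟩ := mem_saws.1 (mem_bridges.1 hυ).1
    have hυ'0 : reflectWalk k υ 0 = 0 := by rw [reflectWalk_apply, hυ0, vrefl_zero]
    have hb := concatWalk_mem_bridges_add hω hυ'
    rw [← two_mul] at hb
    rw [Finset.mem_coe, mem_windowBridges]
    refine ⟨hb, ?_, ?_⟩
    · rw [two_mul, concatWalk_apply_add _ _ hυ'0, vproj_add, reflectWalk_apply, vproj_vrefl, hωe, hυe,
        add_neg_cancel]
    · intro m hm i hi
      simp only [winLo, winHi]
      by_cases h : m ≤ N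
      · rw [concatWalk_apply_of_le _ _ h]
        have h1 := loProf_le (k := k) ω h hi
        have h2 := le_hiProf (k := k) ω h hi
        rw [hωlo] at h1
        rw [hωhi] at h2
        exact ⟨(min_le_left _ _).trans h1, h2.trans (le_max_left _ _)⟩
      · obtain ⟨j, rfl⟩ : ∃ j, m = N + j := ⟨m - N, by omega⟩
        rw [concatWalk_apply_add _ _ hυ'0, Pi.add_apply, reflectWalk_apply_of_le _ _ hi]
        have hj : j ≤ N := by omega
        have h1 := loProf_le (k := k) υ hj hi
        have h2 := le_hiProf (k := k) υ hj hi
        rw [hυlo] at h1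
        rw [hυhi] at h2
        have he : ω N i = e i := by
          have := congrFun hωe i
          rwa [vproj_apply_of_le k _ hi] at this
        rw [he]
        exact ⟨(min_le_right _ _).trans (by linarith), le_trans (by linarith) (le_max_right _ _)⟩
  · rintro ⟨ω, υ⟩ hp ⟨ω', υ'⟩ hp' h
    simp only [Finset.mem_coe, Finset.mem_product, mem_profClass] at hp hp'
    dsimp only at h
    have hs := (mem_bridges.1 hp.1.1).1
    have hs' := (mem_bridges.1 hp'.1.1).1
    have ht := reflectWalk_mem_saws (k := k) (mem_bridges.1 hp.2.1).1
    have ht' := reflectWalk_mem_saws (k := k) (mem_bridges.1 hp'.2.1).1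
    obtain ⟨h1, h2⟩ := concatWalk_injective_pieces hs ht hs' ht' h
    simp only [Prod.mk.injEq]
    refine ⟨h1, ?_⟩
    rw [← reflectWalk_reflectWalk k υ, h2, reflectWalk_reflectWalk]

variable {k : ℕ}

/-- **The counting inequality at width `2N`**: for every `N` there is a class size `B` with
`b_N ≤ #offsets³ · B` and `B^{2j} ≤ c_{2jN}(R[k,2N])` for all `j`.
[cite: MadrasSlade1993, §8.2, proof of Theorem 8.2.1, eq. (8.2.14)] -/
theorem exists_pow_le_tubeCount_two_mul (hk : 1 ≤ k) (N : ℕ) :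
    ∃ B : ℕ, bridgeCount d N ≤ (tubeOffsets d k N).card ^ 3 * B ∧
      ∀ j : ℕ, B ^ (2 * j) ≤ tubeCount d k (2 * N) (j * (2 * N)) := by
  obtain ⟨key, -, hkey⟩ := exists_profClass (d := d) k N
  refine ⟨(profClass d k N key).card, hkey, fun j => ?_⟩
  rcases Nat.eq_zero_or_pos (profClass d k N key).card with h0 | hpos
  · rw [h0]
    rcases Nat.eq_zero_or_pos j with rfl | hj
    · simpa using one_le_tubeCount (d := d) hk (2 * N) 0
    · rw [zero_pow (by omega)]; exact Nat.zero_le _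
  · obtain ⟨ω₀, hω₀⟩ := Finset.card_pos.1 hpos
    rw [mem_profClass] at hω₀
    obtain ⟨hω₀b, hkey₀⟩ := hω₀
    have hs₀ := (mem_bridges.1 hω₀b).1
    have hL : ∀ i : Fin d, k ≤ i.val → winLo key i ≤ 0 := by
      intro i hi
      rw [← hkey₀]
      simp only [winLo, profKey]
      obtain ⟨-, h2, -, -, -⟩ := prof_bounds (k := k) hs₀ hi
      exact (min_le_left _ _).trans h2
    have hU : ∀ i : Fin d, k ≤ i.val → 0 ≤ winHi key i := by
      intro i hi
      rw [← hkey₀]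
      simp only [winHi, profKey]
      obtain ⟨-, -, h3, -, -⟩ := prof_bounds (k := k) hs₀ hi
      exact h3.trans (le_max_left _ _)
    have hT : ∀ i : Fin d, k ≤ i.val → winHi key i - winLo key i ≤ ((2 * N : ℕ) : ℤ) := by
      intro i hi
      rw [← hkey₀]
      simp only [winLo, winHi, profKey]
      obtain ⟨h1, h2, h3, h4, h5⟩ := prof_bounds (k := k) hs₀ hi
      have he1 := loProf_le (k := k) (N := N) ω₀ le_rfl hi
      have he2 := le_hiProf (k := k) (N := N) ω₀ le_rfl hi
      rw [vproj_apply_of_le k _ hi]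
      push_cast
      simp only [max_def, min_def]
      split_ifs <;> linarith
    calc (profClass d k N key).card ^ (2 * j) = ((profClass d k N key).card ^ 2) ^ j := by rw [pow_mul]
      _ ≤ (windowBridges d k (winLo key) (winHi key) (2 * N)).card ^ j :=
          Nat.pow_le_pow_left (sq_card_profClass_le hk key) j
      _ ≤ (windowBridges d k (winLo key) (winHi key) (j * (2 * N))).card :=
          card_windowBridges_pow_le k hL hU _ j
      _ ≤ tubeCount d k (2 * N) (j * (2 * N)) := card_windowBridges_le_tubeCount k hL hU hT _

/-! ### The rate -/

/-- **The rate at width `2N`**: for `N ≥ 1`,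
`log μ - log μ(R[k,2N]) ≤ (log μ + π√(2N/3) + log N + 3 log #offsets)/N`.
[cite: MadrasSlade1993, Theorem 8.2.1, eq. (8.2.12); §3.1 eq. (3.1.7)] -/
theorem log_sub_log_tubeConnectiveConstant_two_mul_le (hk : 1 ≤ k) {N : ℕ} (hN : 1 ≤ N) :
    Real.log (connectiveConstant d) - Real.log (tubeConnectiveConstant d k (2 * N)) ≤
      (Real.log (connectiveConstant d) + Real.pi * Real.sqrt (2 * N / 3) + Real.log N +
        3 * Real.log ((tubeOffsets d k N).card)) / N := by
  obtain ⟨B, hbB, hB⟩ := exists_pow_le_tubeCount_two_mul (d := d) hk N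
  set μ := connectiveConstant d with hμdef
  set P : ℝ := ((tubeOffsets d k N).card : ℝ) with hPdef
  have hμ : 0 < μ := connectiveConstant_pos d
  have hP : 1 ≤ P := by rw [hPdef]; exact_mod_cast one_le_card_tubeOffsets d k N
  obtain ⟨n, rfl⟩ : ∃ n, N = n + 1 := ⟨N - 1, by omega⟩
  have h1 : μ ^ n ≤ ((n : ℝ) + 1) * Real.exp (Real.pi * Real.sqrt (2 * (n + 1) / 3)) *
      bridgeCount d (n + 1) :=
    (pow_connectiveConstant_le_count d n).trans (count_le_sharp_mul_bridgeCount n)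
  have h2 : (bridgeCount d (n + 1) : ℝ) ≤ P ^ 3 * B := by rw [hPdef]; exact_mod_cast hbB
  have hBpos : (0 : ℝ) < B := by
    have : (0 : ℝ) < bridgeCount d (n + 1) := by exact_mod_cast one_le_bridgeCount (d := d) (n + 1)
    have hP0 : 0 < P ^ 3 := by positivity
    nlinarith [this, h2, hP0]
  have h3 : μ ^ n ≤ ((n : ℝ) + 1) * Real.exp (Real.pi * Real.sqrt (2 * (n + 1) / 3)) * (P ^ 3 * B) :=
    h1.trans (mul_le_mul_of_nonneg_left h2 (by positivity))
  have hn1 : (0 : ℝ) < (n : ℝ) + 1 := by positivity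
  have h4 : (B : ℝ) ^ (1 / ((n : ℝ) + 1)) ≤ tubeConnectiveConstant d k (2 * (n + 1)) := by
    have h := rpow_le_tubeConnectiveConstant (d := d) hk (T := 2 * (n + 1)) (M := 2 * (n + 1))
      (B := B ^ 2) (by omega) (fun j => by rw [← pow_mul]; exact hB j)
    have e : ((B ^ 2 : ℕ) : ℝ) ^ (1 / ((2 * (n + 1) : ℕ) : ℝ)) = (B : ℝ) ^ (1 / ((n : ℝ) + 1)) := by
      push_cast
      rw [← Real.rpow_natCast (B : ℝ) 2, ← Real.rpow_mul hBpos.le]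
      congr 1
      push_cast
      field_simp
    rwa [e] at h
  have hT : 0 < tubeConnectiveConstant d k (2 * (n + 1)) := tubeConnectiveConstant_pos hk _
  have hlog4 : Real.log B ≤ ((n : ℝ) + 1) * Real.log (tubeConnectiveConstant d k (2 * (n + 1))) := by
    have h := Real.log_le_log (Real.rpow_pos_of_pos hBpos _) h4
    rw [Real.log_rpow hBpos] at h
    have h' := mul_le_mul_of_nonneg_left h hn1.le
    rwa [← mul_assoc, mul_one_div_cancel hn1.ne', one_mul] at h'
  have hlog3 : (n : ℝ) * Real.log μ ≤
      Real.log ((n : ℝ) + 1) + Real.pi * Real.sqrt (2 * (n + 1) / 3) + 3 * Real.log P + Real.log B := by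
    have := Real.log_le_log (pow_pos hμ n) h3
    rw [Real.log_pow, Real.log_mul (by positivity) (by positivity),
      Real.log_mul (by positivity) (by positivity), Real.log_exp,
      Real.log_mul (by positivity) hBpos.ne', Real.log_pow] at this
    push_cast at this
    linarith
  push_cast
  rw [le_div_iff₀ hn1]
  nlinarith [hlog3, hlog4, Real.log_nonneg hP]

/-- `√(2/3) · √2 = 2/√3`. [folklore] -/
private theorem sqrt_two_thirds_mul_sqrt_two : Real.sqrt (2 / 3) * Real.sqrt 2 = 2 / Real.sqrt 3 := by
  rw [← Real.sqrt_mul (by norm_num), show (2 / 3 : ℝ) * 2 = 4 / 3 by norm_num, Real.sqrt_div' _ (by norm_num : (0:ℝ) ≤ 3),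
    show Real.sqrt 4 = 2 by rw [show (4 : ℝ) = 2 ^ 2 by norm_num, Real.sqrt_sq (by norm_num)]]

/-- `2π/√3 = 3.6275… ≤ 3.6277`. [folklore] -/
private theorem two_pi_div_sqrt_three_le : 2 * Real.pi / Real.sqrt 3 ≤ 3.6277 := by
  have hπ := Real.pi_lt_d6
  have hs : (1.7320508 : ℝ) < Real.sqrt 3 := by
    rw [Real.lt_sqrt (by norm_num)]; norm_num
  have hs0 : 0 < Real.sqrt 3 := by linarith
  rw [div_le_iff₀ hs0]
  nlinarith [Real.pi_pos]

/-- **Locality of `μ` in tubes and slabs at width `2N`, two-term form**: for `d ≥ 1`, `1 ≤ k` and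
every `T ≥ 2`, `log μ - log μ(R[k,T]) ≤ (2π/√3)/√(T-1) + 2 (log μ + (6d+1) log T)/(T-1)`.
[cite: MadrasSlade1993, Theorem 8.2.1, eq. (8.2.12); §3.1 eq. (3.1.7)] -/
theorem log_sub_log_tubeConnectiveConstant_le_two_mul (hk : 1 ≤ k) {T : ℕ} (hT : 2 ≤ T) :
    Real.log (connectiveConstant d) - Real.log (tubeConnectiveConstant d k T) ≤
      2 * Real.pi / Real.sqrt 3 / Real.sqrt ((T : ℝ) - 1) +
        2 * (Real.log (connectiveConstant d) + (6 * (d : ℝ) + 1) * Real.log T) / ((T : ℝ) - 1) := by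
  set μ := connectiveConstant d with hμdef
  have hμ1 : 1 ≤ μ := one_le_connectiveConstant d
  have hlogμ : 0 ≤ Real.log μ := Real.log_nonneg hμ1
  set N := T / 2 with hNdef
  have hN1 : 1 ≤ N := by omega
  have h2N : 2 * N ≤ T := by omega
  have hT21 : T ≤ 2 * N + 1 := by omega
  have hNr : (1 : ℝ) ≤ N := by exact_mod_cast hN1
  have hTr : (2 : ℝ) ≤ T := by exact_mod_cast hT
  have hT1 : (0 : ℝ) < (T : ℝ) - 1 := by linarith
  have hT1N : (T : ℝ) - 1 ≤ 2 * N := by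
    have : (T : ℝ) ≤ 2 * N + 1 := by exact_mod_cast hT21
    linarith
  have hNT : (N : ℝ) ≤ T := by exact_mod_cast (show N ≤ T by omega)
  have h2N1T : (2 * (N : ℝ) + 1) ≤ 2 * T := by exact_mod_cast (show 2 * N + 1 ≤ 2 * T by omega)
  have hmono' : Real.log (tubeConnectiveConstant d k (2 * N)) ≤
      Real.log (tubeConnectiveConstant d k T) :=
    Real.log_le_log (tubeConnectiveConstant_pos hk _) (tubeConnectiveConstant_mono k h2N)
  have hrate := log_sub_log_tubeConnectiveConstant_two_mul_le (d := d) hk hN1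
  have hsN0 : 0 < Real.sqrt N := Real.sqrt_pos.2 (by linarith)
  have hNsq : (N : ℝ) = Real.sqrt N * Real.sqrt N := (Real.mul_self_sqrt (by linarith)).symm
  have hsqrt : Real.sqrt (2 * N / 3) = Real.sqrt (2 / 3) * Real.sqrt N := by
    rw [← Real.sqrt_mul (by norm_num)]; congr 1; ring
  have hlog2 : Real.log 2 ≤ Real.log T := Real.log_le_log (by norm_num) hTr
  have hlogT : 0 ≤ Real.log T := Real.log_nonneg (by linarith)
  have hP : Real.log ((tubeOffsets d k N).card : ℝ) ≤ 2 * d * Real.log T := by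
    have h1 : ((tubeOffsets d k N).card : ℝ) ≤ (2 * N + 1 : ℝ) ^ d := by
      exact_mod_cast card_tubeOffsets_le d k N
    have h2 := Real.log_le_log (by exact_mod_cast one_le_card_tubeOffsets d k N) h1
    rw [Real.log_pow] at h2
    have h3 : Real.log (2 * N + 1 : ℝ) ≤ Real.log (2 * T) := Real.log_le_log (by linarith) h2N1T
    rw [Real.log_mul (by norm_num) (by linarith)] at h3
    have hd : (0 : ℝ) ≤ d := Nat.cast_nonneg d
    nlinarith
  have hlogN : Real.log N ≤ Real.log T := Real.log_le_log (by linarith) hNT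
  -- `1/√N ≤ √2/√(T-1)` and `1/N ≤ 2/(T-1)`
  have hs1 : Real.sqrt ((T : ℝ) - 1) ≤ Real.sqrt 2 * Real.sqrt N := by
    rw [← Real.sqrt_mul (by norm_num)]
    exact Real.sqrt_le_sqrt hT1N
  have hsT0 : 0 < Real.sqrt ((T : ℝ) - 1) := Real.sqrt_pos.2 hT1
  have hs3 : 0 < Real.sqrt 3 := Real.sqrt_pos.2 (by norm_num)
  have hA : Real.pi * Real.sqrt (2 * N / 3) / N ≤ 2 * Real.pi / Real.sqrt 3 / Real.sqrt ((T : ℝ) - 1) := by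
    rw [hsqrt, div_le_div_iff₀ (by linarith) hsT0]
    have h0 : 0 ≤ Real.pi * Real.sqrt (2 / 3) := by positivity
    calc Real.pi * (Real.sqrt (2 / 3) * Real.sqrt N) * Real.sqrt ((T : ℝ) - 1)
        = (Real.pi * Real.sqrt (2 / 3)) * (Real.sqrt N * Real.sqrt ((T : ℝ) - 1)) := by ring
      _ ≤ (Real.pi * Real.sqrt (2 / 3)) * (Real.sqrt N * (Real.sqrt 2 * Real.sqrt N)) :=
          mul_le_mul_of_nonneg_left (mul_le_mul_of_nonneg_left hs1 hsN0.le) h0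
      _ = Real.pi * (Real.sqrt (2 / 3) * Real.sqrt 2) * (Real.sqrt N * Real.sqrt N) := by ring
      _ = 2 * Real.pi / Real.sqrt 3 * N := by rw [sqrt_two_thirds_mul_sqrt_two, ← hNsq]; field_simp
  have hB : (Real.log μ + Real.log N + 3 * Real.log ((tubeOffsets d k N).card : ℝ)) / N ≤
      2 * (Real.log μ + (6 * (d : ℝ) + 1) * Real.log T) / ((T : ℝ) - 1) := by
    rw [div_le_div_iff₀ (by linarith) hT1]
    have hnum : Real.log μ + Real.log N + 3 * Real.log ((tubeOffsets d k N).card : ℝ) ≤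
        Real.log μ + (6 * (d : ℝ) + 1) * Real.log T := by nlinarith
    have hnn : 0 ≤ Real.log μ + (6 * (d : ℝ) + 1) * Real.log T := by positivity
    calc (Real.log μ + Real.log N + 3 * Real.log ((tubeOffsets d k N).card : ℝ)) * ((T : ℝ) - 1)
        ≤ (Real.log μ + (6 * (d : ℝ) + 1) * Real.log T) * ((T : ℝ) - 1) :=
          mul_le_mul_of_nonneg_right hnum hT1.le
      _ ≤ (Real.log μ + (6 * (d : ℝ) + 1) * Real.log T) * (2 * N) := mul_le_mul_of_nonneg_left hT1N hnn
      _ = 2 * (Real.log μ + (6 * (d : ℝ) + 1) * Real.log T) * N := by ring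
  have hsplit : (Real.log μ + Real.pi * Real.sqrt (2 * N / 3) + Real.log N +
      3 * Real.log ((tubeOffsets d k N).card : ℝ)) / N =
      Real.pi * Real.sqrt (2 * N / 3) / N +
        (Real.log μ + Real.log N + 3 * Real.log ((tubeOffsets d k N).card : ℝ)) / N := by ring
  rw [hsplit] at hrate
  linarith

/-- **The planar strip at width `2N`**: for every `T ≥ 2`,
`log μ(ℤ²) - log μ(R[1,T]) ≤ 3.6277/√(T-1) + (8 log T + 6.6)/(T-1)`
(`#offsets = 2N+1 ≤ 2T`, `log μ(ℤ²) ≤ 1.2`, `log 2 ≤ 0.7`). [cite: MadrasSlade1993, Theorem 8.2.1, eq. (8.2.12); §3.1 eq. (3.1.7)] -/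
theorem log_sub_log_stripConnectiveConstant_le_two_mul {T : ℕ} (hT : 2 ≤ T) :
    Real.log (connectiveConstant 2) - Real.log (tubeConnectiveConstant 2 1 T) ≤
      3.6277 / Real.sqrt ((T : ℝ) - 1) + (8 * Real.log T + 6.6) / ((T : ℝ) - 1) := by
  have hk : 1 ≤ 1 := le_rfl
  set μ := connectiveConstant 2 with hμdef
  have hμ1 : 1 ≤ μ := one_le_connectiveConstant 2
  have hμ3 : μ ≤ 3 := by
    have := connectiveConstant_le 2 (by norm_num)
    norm_num at this
    exact this
  have hlogμ : 0 ≤ Real.log μ := Real.log_nonneg hμ1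
  have hlog2 : Real.log 2 < 0.7 := by linarith [Real.log_two_lt_d9]
  have hlogμ' : Real.log μ ≤ 1.2 := by
    have h1 := Real.log_le_log (by linarith) hμ3
    have h2 : Real.log 3 = Real.log 2 + Real.log (3 / 2) := by
      rw [← Real.log_mul (by norm_num) (by norm_num)]; norm_num
    have h3 : Real.log (3 / 2) ≤ 3 / 2 - 1 := Real.log_le_sub_one_of_pos (by norm_num)
    linarith
  set N := T / 2 with hNdef
  have hN1 : 1 ≤ N := by omega
  have h2N : 2 * N ≤ T := by omega
  have hT21 : T ≤ 2 * N + 1 := by omega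
  have hNr : (1 : ℝ) ≤ N := by exact_mod_cast hN1
  have hTr : (2 : ℝ) ≤ T := by exact_mod_cast hT
  have hT1 : (0 : ℝ) < (T : ℝ) - 1 := by linarith
  have hT1N : (T : ℝ) - 1 ≤ 2 * N := by
    have : (T : ℝ) ≤ 2 * N + 1 := by exact_mod_cast hT21
    linarith
  have hNT : (N : ℝ) ≤ T := by exact_mod_cast (show N ≤ T by omega)
  have h2N1T : (2 * (N : ℝ) + 1) ≤ 2 * T := by exact_mod_cast (show 2 * N + 1 ≤ 2 * T by omega)
  have hmono' : Real.log (tubeConnectiveConstant 2 1 (2 * N)) ≤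
      Real.log (tubeConnectiveConstant 2 1 T) :=
    Real.log_le_log (tubeConnectiveConstant_pos hk _) (tubeConnectiveConstant_mono 1 h2N)
  have hrate := log_sub_log_tubeConnectiveConstant_two_mul_le (d := 2) hk hN1
  rw [card_tubeOffsets_two_one] at hrate
  have hsN0 : 0 < Real.sqrt N := Real.sqrt_pos.2 (by linarith)
  have hNsq : (N : ℝ) = Real.sqrt N * Real.sqrt N := (Real.mul_self_sqrt (by linarith)).symm
  have hsqrt : Real.sqrt (2 * N / 3) = Real.sqrt (2 / 3) * Real.sqrt N := by
    rw [← Real.sqrt_mul (by norm_num)]; congr 1; ring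
  have hlogT : 0 ≤ Real.log T := Real.log_nonneg (by linarith)
  have hP : Real.log ((2 * N + 1 : ℕ) : ℝ) ≤ 0.7 + Real.log T := by
    push_cast
    have h3 : Real.log (2 * N + 1 : ℝ) ≤ Real.log (2 * T) := Real.log_le_log (by linarith) h2N1T
    rw [Real.log_mul (by norm_num) (by linarith)] at h3
    linarith
  have hlogN : Real.log N ≤ Real.log T := Real.log_le_log (by linarith) hNT
  have hs1 : Real.sqrt ((T : ℝ) - 1) ≤ Real.sqrt 2 * Real.sqrt N := by
    rw [← Real.sqrt_mul (by norm_num)]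
    exact Real.sqrt_le_sqrt hT1N
  have hsT0 : 0 < Real.sqrt ((T : ℝ) - 1) := Real.sqrt_pos.2 hT1
  have hs3 : 0 < Real.sqrt 3 := Real.sqrt_pos.2 (by norm_num)
  have hc := two_pi_div_sqrt_three_le
  have hA : Real.pi * Real.sqrt (2 * N / 3) / N ≤ 3.6277 / Real.sqrt ((T : ℝ) - 1) := by
    rw [hsqrt, div_le_div_iff₀ (by linarith) hsT0]
    have h0 : 0 ≤ Real.pi * Real.sqrt (2 / 3) := by positivity
    calc Real.pi * (Real.sqrt (2 / 3) * Real.sqrt N) * Real.sqrt ((T : ℝ) - 1)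
        = (Real.pi * Real.sqrt (2 / 3)) * (Real.sqrt N * Real.sqrt ((T : ℝ) - 1)) := by ring
      _ ≤ (Real.pi * Real.sqrt (2 / 3)) * (Real.sqrt N * (Real.sqrt 2 * Real.sqrt N)) :=
          mul_le_mul_of_nonneg_left (mul_le_mul_of_nonneg_left hs1 hsN0.le) h0
      _ = Real.pi * (Real.sqrt (2 / 3) * Real.sqrt 2) * (Real.sqrt N * Real.sqrt N) := by ring
      _ = 2 * Real.pi / Real.sqrt 3 * N := by rw [sqrt_two_thirds_mul_sqrt_two, ← hNsq]; field_simp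
      _ ≤ 3.6277 * N := mul_le_mul_of_nonneg_right hc (by linarith)
  have hB : (Real.log μ + Real.log N + 3 * Real.log ((2 * N + 1 : ℕ) : ℝ)) / N ≤
      (8 * Real.log T + 6.6) / ((T : ℝ) - 1) := by
    rw [div_le_div_iff₀ (by linarith) hT1]
    have hnum : Real.log μ + Real.log N + 3 * Real.log ((2 * N + 1 : ℕ) : ℝ) ≤ 3.3 + 4 * Real.log T := by
      linarith
    have hnn : (0 : ℝ) ≤ 3.3 + 4 * Real.log T := by positivity
    calc (Real.log μ + Real.log N + 3 * Real.log ((2 * N + 1 : ℕ) : ℝ)) * ((T : ℝ) - 1)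
        ≤ (3.3 + 4 * Real.log T) * ((T : ℝ) - 1) := mul_le_mul_of_nonneg_right hnum hT1.le
      _ ≤ (3.3 + 4 * Real.log T) * (2 * N) := mul_le_mul_of_nonneg_left hT1N hnn
      _ = (8 * Real.log T + 6.6) * N := by ring
  have hsplit : (Real.log μ + Real.pi * Real.sqrt (2 * N / 3) + Real.log N +
      3 * Real.log ((2 * N + 1 : ℕ) : ℝ)) / N =
      Real.pi * Real.sqrt (2 * N / 3) / N +
        (Real.log μ + Real.log N + 3 * Real.log ((2 * N + 1 : ℕ) : ℝ)) / N := by ring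
  rw [hsplit] at hrate
  linarith

/-- **The leading constant `2π/√3`**: for every `η > 0`, for all sufficiently large `T`,
`log μ - log μ(R[k,T]) ≤ (2π/√3 + η)/√T`. [cite: MadrasSlade1993, Theorem 8.2.1, eq. (8.2.12); §3.1 eq. (3.1.7)] -/
theorem eventually_log_sub_log_tubeConnectiveConstant_le_two_mul (hk : 1 ≤ k) {η : ℝ} (hη : 0 < η) :
    ∀ᶠ T : ℕ in atTop, Real.log (connectiveConstant d) - Real.log (tubeConnectiveConstant d k T) ≤
      (2 * Real.pi / Real.sqrt 3 + η) / Real.sqrt T := by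
  obtain ⟨c, hc⟩ : ∃ c : ℝ, c = 2 * Real.pi / Real.sqrt 3 := ⟨_, rfl⟩
  obtain ⟨A, hA⟩ : ∃ A : ℝ, A = Real.log (connectiveConstant d) := ⟨_, rfl⟩
  obtain ⟨D, hD⟩ : ∃ D : ℝ, D = 6 * (d : ℝ) + 1 := ⟨_, rfl⟩
  have hs3 : 0 < Real.sqrt 3 := Real.sqrt_pos.2 (by norm_num)
  have hc0 : 0 ≤ c := by rw [hc]; positivity
  have hA0 : 0 ≤ A := by rw [hA]; exact Real.log_nonneg (one_le_connectiveConstant d)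
  have hD0 : 0 ≤ D := by rw [hD]; positivity
  have hnat : Tendsto (fun T : ℕ => (T : ℝ)) atTop atTop := tendsto_natCast_atTop_atTop
  have h1 : Tendsto (fun T : ℕ => 2 * c / (T : ℝ)) atTop (𝓝 0) := by
    have h := (tendsto_inv_atTop_zero.comp hnat).const_mul (2 * c)
    rw [mul_zero] at h
    exact h.congr fun T => by simp [div_eq_mul_inv]
  have hsqrt : Tendsto (fun T : ℕ => Real.sqrt (T : ℝ)) atTop atTop := Real.tendsto_sqrt_atTop.comp hnat
  have h2 : Tendsto (fun T : ℕ => 4 * A / Real.sqrt (T : ℝ)) atTop (𝓝 0) := by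
    have h := (tendsto_inv_atTop_zero.comp hsqrt).const_mul (4 * A)
    rw [mul_zero] at h
    exact h.congr fun T => by simp [div_eq_mul_inv]
  have h3 : Tendsto (fun T : ℕ => 4 * D * (Real.log (T : ℝ) / Real.sqrt (T : ℝ))) atTop (𝓝 0) := by
    have hlo := (isLittleO_log_rpow_atTop (by norm_num : (0 : ℝ) < 1 / 2)).tendsto_div_nhds_zero
    have hlo' : Tendsto (fun x : ℝ => Real.log x / Real.sqrt x) atTop (𝓝 0) := by
      refine hlo.congr' ?_
      filter_upwards [eventually_ge_atTop 0] with x hx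
      rw [Real.sqrt_eq_rpow]
    simpa using (hlo'.comp hnat).const_mul (4 * D)
  have hsum : Tendsto (fun T : ℕ => 2 * c / (T : ℝ) + 4 * A / Real.sqrt (T : ℝ) +
      4 * D * (Real.log (T : ℝ) / Real.sqrt (T : ℝ))) atTop (𝓝 0) := by
    simpa using (h1.add h2).add h3
  have hev := hsum.eventually (Iio_mem_nhds hη)
  filter_upwards [hev, eventually_ge_atTop 4] with T hg hT4
  have hg : 2 * c / (T : ℝ) + 4 * A / Real.sqrt (T : ℝ) +
      4 * D * (Real.log (T : ℝ) / Real.sqrt (T : ℝ)) < η := hg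
  have hmain := log_sub_log_tubeConnectiveConstant_le_two_mul (d := d) hk (show 2 ≤ T by omega)
  rw [← hc, ← hA, ← hD] at hmain
  rw [← hc]
  have hTr : (4 : ℝ) ≤ T := by exact_mod_cast hT4
  have hT1 : (0 : ℝ) < (T : ℝ) - 1 := by linarith
  have hsT1 : 0 < Real.sqrt ((T : ℝ) - 1) := Real.sqrt_pos.2 hT1
  have hT1sq : Real.sqrt ((T : ℝ) - 1) * Real.sqrt ((T : ℝ) - 1) = (T : ℝ) - 1 :=
    Real.mul_self_sqrt hT1.le
  have hle1 : Real.sqrt ((T : ℝ) - 1) ≤ Real.sqrt (T : ℝ) := Real.sqrt_le_sqrt (by linarith)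
  have hL0 : 0 ≤ Real.log (T : ℝ) := Real.log_nonneg (by linarith)
  set s := Real.sqrt (T : ℝ) with hsdef
  set L := Real.log (T : ℝ) with hLdef
  have hsT : 0 < s := Real.sqrt_pos.2 (by linarith)
  have hs2 : (T : ℝ) = s * s := (Real.mul_self_sqrt (by linarith : (0 : ℝ) ≤ T)).symm
  have hs4 : 4 ≤ s * s := by rw [← hs2]; exact hTr
  have hss1 : 0 < s * s - 1 := by linarith
  have hterm1 : c / Real.sqrt ((T : ℝ) - 1) ≤ c * s / (s * s - 1) := by
    rw [div_le_div_iff₀ hsT1 hss1]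
    calc c * (s * s - 1) = c * (Real.sqrt ((T : ℝ) - 1) * Real.sqrt ((T : ℝ) - 1)) := by
          rw [hT1sq, hs2]
      _ ≤ c * (s * Real.sqrt ((T : ℝ) - 1)) :=
          mul_le_mul_of_nonneg_left (mul_le_mul_of_nonneg_right hle1 hsT1.le) hc0
      _ = c * s * Real.sqrt ((T : ℝ) - 1) := by ring
  have hterm2 : 2 * (A + D * L) / ((T : ℝ) - 1) = 2 * (A + D * L) / (s * s - 1) := by rw [hs2]
  have hsum' : c * s / (s * s - 1) + 2 * (A + D * L) / (s * s - 1) =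
      (c * s + 2 * (A + D * L)) / (s * s - 1) := by ring
  have hpoly : (c * s + 2 * (A + D * L)) / (s * s - 1) ≤
      (c * (s * s) + 2 * c + 4 * A * s + 4 * D * L * s) / (s * s * s) := by
    rw [div_le_div_iff₀ hss1 (by positivity)]
    have hkey : 0 ≤ (s * s - 2) * (c + 2 * A * s + 2 * D * L * s) :=
      mul_nonneg (by linarith) (by positivity)
    nlinarith [hkey]
  have hrhs : (c * (s * s) + 2 * c + 4 * A * s + 4 * D * L * s) / (s * s * s) =
      (c + (2 * c / (s * s) + 4 * A / s + 4 * D * (L / s))) / s := by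
    field_simp
    ring
  have hg' : (c + (2 * c / (s * s) + 4 * A / s + 4 * D * (L / s))) / s ≤ (c + η) / s := by
    rw [hs2] at hg
    exact div_le_div_of_nonneg_right (by linarith [hg.le]) hsT.le
  linarith [hmain, hterm1, hterm2.le, hterm2.ge, hsum'.le, hsum'.ge, hpoly, hrhs.le, hrhs.ge, hg']

/-- The `∃ T₀` form of `eventually_log_sub_log_tubeConnectiveConstant_le_two_mul` (the shape
`stub_locality_sharpHW_width2` of the explicit-rate table): for every `η > 0` there is `T₀` with
`log μ - log μ(R[k,T]) ≤ (2π/√3 + η)/√T` for all `T ≥ T₀`.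
[cite: MadrasSlade1993, Theorem 8.2.1, eq. (8.2.12); §3.1 eq. (3.1.7)] -/
theorem stub_locality_sharpHW_width2 (hk : 1 ≤ k) {η : ℝ} (hη : 0 < η) :
    ∃ T₀ : ℕ, ∀ T : ℕ, T₀ ≤ T →
      Real.log (connectiveConstant d) - Real.log (tubeConnectiveConstant d k T) ≤
        (2 * Real.pi / Real.sqrt 3 + η) / Real.sqrt T :=
  Filter.eventually_atTop.1 (eventually_log_sub_log_tubeConnectiveConstant_le_two_mul hk hη)

end Classes

end Literature.Probability.RandomPlanarGeometry.SAW.Zd
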